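import Summits.BirchSwinnertonDyer.BirchSwinnertonDyer.Theorems.CMKolyvaginAtInertTwoAdaptiveDataTelescopeStep
import HarnessLib

/-!
# Route `CMKolyvaginAtInertTwo`, crux `CMKolyvaginExactAtInertTwo` (stmt-BirchSwinnertonDyer-24277):
# THE ADAPTIVE SPLIT-FORM TELESCOPE WITH THE KILL CLAUSE, I — the step, with the Cassels–Tate value
# formula `hCTV` asked ONLY for classes in the isotropic lift subgroup `W`

Seat `bsd-line-cmk2-p1` g17 (cell `bsd-print-cf2`); helper (`--supports stmt-BirchSwinnertonDyer-24277`).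
THEOREMS ONLY: no definition, no named fact, no `sorry`; no item is closed; BSD is not proved by this.

WHY (T2 kit interface repair, KERNEL-STATUS-p2-port.md §17). The T2 assembly of the crux's upper half
(`KolyvaginPairDataTwo.card_mul_card_le_two_pow_two_mul_of_injective`, p690708) consumes McCallum's
Cassels–Tate value formula `hCTV` for EVERY test class `t ∈ Sd.Sel` with `p^N t = 0`, `N + M₀ ≤ M`;
the re-based member formulas over `ℚ` that are to supply it (`hV₁/hV₂_canonical_of_kill`, p708946)
need the test class killed by `2^L` inside the level-`2^{2L}` carrier (first-case data of the
Cassels–Tate pairing at level `2^L`; displayed there as `2^{2M₀} • t = 0` with `2M₀ ≤ L`). With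
`M = 2L` the telescope's `N ≤ 2L − M₀` never gives that: AS LANDED THE TWO HALVES OF THE KIT DO NOT
COMPOSE. But in McCallum's induction (`KolyvaginAdaptiveData.adaptive_step`, p676422) the value
formula is invoked exactly once, with `t := z ∈ Act ≤ W` and `p^i c(ℓn) ∈ Z' ⊔ Pas ≤ W`, `W` the
ISOTROPIC subgroup (in the assembly: the sum of the two lift groups, killed by the exponent `2^k` of
`Ш(E^{ε}/ℚ)[2^∞] ⊕ Sel_{2^M}(E^{−ε}/ℚ)`). This file re-proves the step with `hCTV` weakened
accordingly — both arguments displayed as members of `W` — proof VERBATIM otherwise (seat g13's,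
after g12's `KolyvaginAdaptiveTwo.adaptive_step`):

* `adaptive_step_memW`.

Sequel (`…AdaptiveDataTelescopeMemWAtTwo`): the induction and T4 with the same clause; then
`card_mul_card_le_two_pow_two_mul_of_injective_of_kill` exposes `(p^k) • t = 0`.

References: [McCallumLMS1991] §5 Thm. 5.4 (proof, (16)–(23)), Prop. 4.7, Lemma 5.3, Cor. 3.2
(held `book:editornd-l-functions-arithmetic`, PDF pp. 283–290).
-/

-- single-conjunct summit: `Summit.BirchSwinnertonDyer.BirchSwinnertonDyer.…` repeats the name by design
set_option linter.dupNamespace false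
set_option autoImplicit false

open scoped Classical

namespace Summit.BirchSwinnertonDyer.BirchSwinnertonDyer.Theorems.KolyvaginAdaptiveData

open Literature.NumberTheory.EllipticCurves Literature.NumberTheory.EllipticCurves.KolyvaginDescent
open KolyvaginAdaptiveTwo (exists_split_not_mem_sup)

variable {V : Type*} [AddCommGroup V] {Pl : Type*}

/-! ## Plumbing: thin wrappers over the `SplitDataM.expo` API -/

/-- `p^{expo s} • s = 0`. [folklore] -/
private theorem pow_expo_zsmul (S : SplitDataM V Pl) (s : V) : ((S.p : ℤ) ^ S.expo s) • s = 0 :=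
  (S.expo_spec s).1

/-- `p^{expo s - 1} • s ≠ 0` when `expo s ≠ 0`. [folklore] -/
private theorem pow_expo_sub_one_zsmul_ne_zero (S : SplitDataM V Pl) {s : V} (h : S.expo s ≠ 0) :
    ((S.p : ℤ) ^ (S.expo s - 1)) • s ≠ 0 :=
  (S.expo_spec s).2 _ (Nat.sub_one_lt h)

/-- `expo s ≠ 0` for `s ≠ 0`. [folklore] -/
private theorem expo_ne_zero_of_ne_zero (S : SplitDataM V Pl) {s : V} (hs : s ≠ 0) : S.expo s ≠ 0 :=
  fun h ↦ hs ((S.expo_le_M_and_eq_zero_iff s).2.mp h)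

/-! ## One Kolyvagin prime, `hCTV` on `W` only -/

/-- **THE ADAPTIVE STEP of McCallum's Thm. 5.4 over `SplitDataM`, with the Cassels–Tate value formula
`hCTV` asked only for BOTH arguments in the isotropic subgroup `W`** (`p^j c(ℓm) ∈ W`, `t ∈ W`
displayed). Same state, same output as `adaptive_step` (chain `n`, used exponent `Sg`, pools
`Act`/`Pas` in `W`, (IND), (19)/(23), invariant (I); a Kolyvagin prime `ℓ ∤ n` from the order-form
binder `hCeb₂`, `#Act = p^{expo z} · #Z'`, (I) for `ℓ n` with `Sg + expo z`). The one use of `hCTV`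
has `t := z ∈ Act ≤ W` and `p^i c(ℓ n) ∈ Z' ⊔ Pas ≤ W`.
[cite: McCallumLMS1991, §5 Thm. 5.4 (proof, (16)–(23)), Prop. 4.7, Lemma 5.3, Cor. 3.2 (PDF pp. 283–290)] -/
theorem adaptive_step_memW (S : SplitDataM V Pl) (W : AddSubgroup V) {R : Type*} [AddCommGroup R]
    (P : S.Sel →+ S.Sel →+ R)
    (hCTV : ∀ ℓ m : ℕ, S.Kol ℓ → KolSupp S.Kol (ℓ * m) → ¬ ℓ ∣ m →
      ∀ (j N a b : ℕ) (t : V) (ht : t ∈ S.Sel) (hz : ((S.p : ℤ) ^ j) • S.c (ℓ * m) ∈ S.Sel),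
      ((S.p : ℤ) ^ j) • S.c (ℓ * m) ∈ W → t ∈ W →
      ((S.p : ℤ) ^ N) • t = 0 → t ∈ S.eig (S.ε * (-1) ^ (ℓ * m).primeFactors.card) →
      (∀ q ∈ m.primeFactors, t ∈ S.A q) → S.M - S.M₀ ≤ j → N + S.M₀ ≤ S.M → N ≤ j → a + b + 1 = N →
      ((S.p : ℤ) ^ (a + (j - N))) • S.c m ∉ S.A ℓ → ((S.p : ℤ) ^ b) • t ∉ S.A ℓ →
      P ⟨_, hz⟩ ⟨t, ht⟩ ≠ 0)
    (Δ : AddSubgroup V)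
    (hΔpure : ∀ d ∈ Δ, ∀ e : ℤ, (e = 1 ∨ e = -1) → d ∈ S.eig e → d = 0)
    (hCeb₂ : ∀ (T : Finset V) (g₁ g₂ : V) (ν : ℤ) (I : ℕ), (ν = 1 ∨ ν = -1) → g₁ ∈ S.eig ν →
      g₂ ∈ S.eig (-ν) → (∀ t ∈ T, ∃ e : ℤ, (e = 1 ∨ e = -1) ∧ t ∈ S.eig e) →
      (g₁ ≠ 0 → ((S.p : ℤ) ^ (S.expo g₁ - 1)) • g₁ ∉ Δ ⊔ AddSubgroup.closure (T : Set V)) →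
      (1 ≤ I → ∀ d ∈ Δ, ∀ u ∈ AddSubgroup.closure (T : Set V), u ∈ S.eig (-ν) →
        ∀ v ∈ AddSubgroup.closure (T : Set V), v ∈ S.eig ν → (S.p : ℤ) • v = 0 →
        ((S.p : ℤ) ^ (I - 1)) • g₂ ≠ d + u + v) →
      ∀ b : ℕ, ∃ ℓ, b < ℓ ∧ S.Kol ℓ ∧
        (∀ t ∈ AddSubgroup.closure (T : Set V), t ∈ S.A ℓ) ∧
        (∀ j < S.expo g₁, ((S.p : ℤ) ^ j) • g₁ ∉ S.A ℓ) ∧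
        (∀ i < I, ((S.p : ℤ) ^ i) • g₂ ∉ S.A ℓ))
    (hWSel : W ≤ S.Sel)
    (hiso : ∀ u, ∀ hu : u ∈ W, ∀ v, ∀ hv : v ∈ W, ∀ (hu' : u ∈ S.Sel) (hv' : v ∈ S.Sel),
      P ⟨u, hu'⟩ ⟨v, hv'⟩ = 0)
    (hroom : ∀ z ∈ W, S.expo z + S.M₀ ≤ S.M)
    (Act Pas : AddSubgroup V) [Finite Act] [Finite Pas] (hAct : Act ≤ W) (hPas : Pas ≤ W)
    (hdisj : Disjoint Act (Pas ⊔ Δ)) {n : ℕ} (hn : KolSupp S.Kol n) (Sg : ℕ)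
    (hActν : ∀ z ∈ Act, z ∈ S.eig (S.ε * (-1) ^ (n.primeFactors.card + 1)))
    (hPasν : ∀ u ∈ Pas, u ∈ S.eig (S.ε * (-1) ^ n.primeFactors.card))
    (hA : ∀ q ∈ n.primeFactors, ∀ z ∈ Act ⊔ Pas, z ∈ S.A q)
    (hI : ∀ i : ℕ, ((S.p : ℤ) ^ i) • S.c n ∈ Act ⊔ Pas → (S.M - S.M₀) + Sg ≤ i) :
    ∃ (ℓ : ℕ) (Z' : AddSubgroup V) (e : ℕ), S.Kol ℓ ∧ KolSupp S.Kol (ℓ * n) ∧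
      (ℓ * n).primeFactors.card = n.primeFactors.card + 1 ∧ Z' ≤ Act ∧
      Nat.card Act = S.p ^ e * Nat.card Z' ∧ (Act ≠ ⊥ → e ≠ 0) ∧
      (∀ q ∈ (ℓ * n).primeFactors, ∀ z ∈ Z' ⊔ Pas, z ∈ S.A q) ∧
      ∀ i : ℕ, ((S.p : ℤ) ^ i) • S.c (ℓ * n) ∈ Z' ⊔ Pas → (S.M - S.M₀) + (Sg + e) ≤ i := by
  have hp := S.hp
  set r := n.primeFactors.card with hr
  set ν : ℤ := S.ε * (-1) ^ (r + 1) with hν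
  have hν1 : ν = 1 ∨ ν = -1 := S.sign_pow_cases (r + 1)
  have hnegν : -ν = S.ε * (-1) ^ r := by rw [hν, pow_succ]; ring
  have hν1' : -ν = 1 ∨ -ν = -1 := by rcases hν1 with h | h <;> simp [h]
  have hτc : S.c n ∈ S.eig (-ν) := by rw [hnegν]; exact S.c_eig n hn
  have hPasν' : ∀ u ∈ Pas, u ∈ S.eig (-ν) := by rw [hnegν]; exact hPasν
  set I := S.M - S.M₀ + Sg with hIdef
  -- (F1): the bottom `p^{I-1} c(n)` avoids `Pas ⊔ Δ`
  have hF1 : 1 ≤ I → ((S.p : ℤ) ^ (I - 1)) • S.c n ∉ Pas ⊔ Δ := fun h1 ↦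
    pow_zsmul_not_mem_sup_of_invariant S hΔpure hν1 hPasν' hτc hI h1
  -- ### the generator `z` (McCallum's `c_{k+1}`, of maximal order in `Act`) and the new pool `Z'`
  have hgen : ∃ z ∈ Act, ∃ Z' : AddSubgroup V, Z' ≤ Act ∧ AddSubgroup.zmultiples z ⊓ Z' = ⊥ ∧
      AddSubgroup.zmultiples z ⊔ Z' = Act ∧ (Act ≠ ⊥ → z ≠ 0) ∧
      (1 ≤ I → ((S.p : ℤ) ^ (I - 1)) • S.c n ∉ Z' ⊔ (Pas ⊔ Δ)) ∧
      ∀ m : ℤ, m • z ≠ 0 → m • z ∉ Z' ⊔ (Pas ⊔ Δ) := by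
    by_cases hbot : Act = ⊥
    · -- dummy step: `g₁ = 0`, `Z' = ⊥ = Act`
      refine ⟨0, zero_mem _, ⊥, bot_le, by simp, ?_, fun h ↦ (h hbot).elim, fun h1 ↦ ?_,
        fun m hm ↦ (hm (zsmul_zero m)).elim⟩
      · rw [AddSubgroup.zmultiples_zero_eq_bot, bot_sup_eq, hbot]
      · rw [bot_sup_eq]
        exact hF1 h1
    · -- real step: `I ≥ 1` since `Act` has a non-zero element (`expo ≥ 1`, room `expo + M₀ ≤ M`)
      obtain ⟨⟨z₀, hz₀⟩, hz₀ne⟩ := AddSubgroup.ne_bot_iff_exists_ne_zero.mp hbot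
      have hz₀ne' : z₀ ≠ 0 := fun h ↦ hz₀ne (Subtype.ext h)
      have h1 : 1 ≤ I := by
        have he := expo_ne_zero_of_ne_zero S hz₀ne'
        have := hroom z₀ (hAct hz₀)
        omega
      obtain ⟨z, hz, hzord, Z', hZ'le, hinf, hsup, -, hβ, hmult⟩ :=
        exists_split_not_mem_sup Act (Pas ⊔ Δ) hbot hdisj (hF1 h1)
      refine ⟨z, hz, Z', hZ'le, hinf, hsup, fun _ hz0 ↦ ?_, fun _ ↦ hβ, hmult⟩
      apply hz₀ne
      have hdvd := AddMonoid.addOrder_dvd_exponent (⟨z₀, hz₀⟩ : Act)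
      rw [← hzord, hz0, addOrderOf_zero, Nat.dvd_one] at hdvd
      exact AddMonoid.addOrderOf_eq_one_iff.mp hdvd
  obtain ⟨z, hz, Z', hZ'le, hinf, hsup, hzne, hβ, hmult⟩ := hgen
  haveI : Finite Z' :=
    Finite.of_injective (AddSubgroup.inclusion hZ'le) (AddSubgroup.inclusion_injective hZ'le)
  -- ### the finite generating set `T` of the new pool `Z' ⊔ Pas`
  have hTfin : ((Z' : Set V) ∪ (Pas : Set V)).Finite := (Set.toFinite _).union (Set.toFinite _)
  set T : Finset V := hTfin.toFinset with hT
  have hTcoe : (T : Set V) = (Z' : Set V) ∪ (Pas : Set V) := hTfin.coe_toFinset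
  have hclT : AddSubgroup.closure (T : Set V) = Z' ⊔ Pas := by
    rw [hTcoe, AddSubgroup.closure_union, AddSubgroup.closure_eq, AddSubgroup.closure_eq]
  have hzν : z ∈ S.eig ν := hActν z hz
  have hTpure : ∀ t ∈ T, ∃ e : ℤ, (e = 1 ∨ e = -1) ∧ t ∈ S.eig e := by
    intro t ht
    rw [← Finset.mem_coe, hTcoe, Set.mem_union] at ht
    rcases ht with ht | ht
    · exact ⟨ν, hν1, hActν t (hZ'le ht)⟩
    · exact ⟨-ν, hν1', hPasν' t ht⟩
  have hsupeq : Δ ⊔ AddSubgroup.closure (T : Set V) = Z' ⊔ (Pas ⊔ Δ) := by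
    rw [hclT, sup_comm, sup_assoc]
  -- (22): `z` will be FULL at `λ` — its bottom avoids `Δ ⊔ ⟨T⟩`
  have hfull : z ≠ 0 → ((S.p : ℤ) ^ (S.expo z - 1)) • z ∉ Δ ⊔ AddSubgroup.closure (T : Set V) := by
    intro hz0
    rw [hsupeq]
    exact hmult _ (pow_expo_sub_one_zsmul_ne_zero S (expo_ne_zero_of_ne_zero S hz0))
  -- (21): `c(n)` of local order `≥ p^I` — its `p^{I-1}`-multiple avoids `Δ + ⟨T⟩`
  have hrel : 1 ≤ I → ∀ d ∈ Δ, ∀ u ∈ AddSubgroup.closure (T : Set V), u ∈ S.eig (-ν) →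
      ∀ v ∈ AddSubgroup.closure (T : Set V), v ∈ S.eig ν → (S.p : ℤ) • v = 0 →
      ((S.p : ℤ) ^ (I - 1)) • S.c n ≠ d + u + v := by
    intro h1 d hd u hu _ v hv _ _ heq
    apply hβ h1
    rw [heq]
    rw [hclT] at hu hv
    have hle : Z' ⊔ Pas ≤ Z' ⊔ (Pas ⊔ Δ) := sup_le_sup_left le_sup_left Z'
    exact add_mem (add_mem (AddSubgroup.mem_sup_right (AddSubgroup.mem_sup_right hd)) (hle hu))
      (hle hv)
  -- ### the Kolyvagin prime `ℓ = ℓ_{k+1}`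
  obtain ⟨ℓ, hnℓ, hℓ, hTA, hzA, hcA⟩ := hCeb₂ T z (S.c n) ν I hν1 hzν hτc hTpure hfull hrel n
  rw [hclT] at hTA
  have hℓp := S.prime_of_kol ℓ hℓ
  have hn0 : n ≠ 0 := hn.1.ne_zero
  have hndvd : ¬ ℓ ∣ n := fun h ↦ by
    have := Nat.le_of_dvd (Nat.pos_of_ne_zero hn0) h
    omega
  have hsupp : KolSupp S.Kol (ℓ * n) := S.kolSupp_mul_of_not_dvd hℓ hn hndvd
  have hcard' : (ℓ * n).primeFactors.card = r + 1 :=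
    SplitDataM.card_primeFactors_mul_of_not_dvd hℓp hn0 hndvd
  -- `#Act = ord z · #Z' = p^{expo z} · #Z'`
  have hcardAct : Nat.card Act = S.p ^ S.expo z * Nat.card Z' := by
    have h1 : (AddSubgroup.zmultiples z).relIndex (AddSubgroup.zmultiples z ⊔ Z') = Nat.card Z' := by
      rw [AddSubgroup.relIndex_sup_left, ← AddSubgroup.inf_relIndex_right, hinf,
        AddSubgroup.relIndex_bot_left]
    have h2 := AddSubgroup.relIndex_mul_relIndex ⊥ (AddSubgroup.zmultiples z)
      (AddSubgroup.zmultiples z ⊔ Z') bot_le le_sup_left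
    rw [AddSubgroup.relIndex_bot_left, AddSubgroup.relIndex_bot_left, h1, hsup, Nat.card_zmultiples,
      S.addOrderOf_eq_pow_expo z] at h2
    exact h2.symm
  have hW : Z' ⊔ Pas ≤ W := sup_le (hZ'le.trans hAct) hPas
  refine ⟨ℓ, Z', S.expo z, hℓ, hsupp, hcard', hZ'le, hcardAct,
    fun h ↦ expo_ne_zero_of_ne_zero S (hzne h), ?_, ?_⟩
  · -- (19)/(23): the pools vanish at the primes of `ℓ n`
    intro q hq w hw
    rw [Nat.primeFactors_mul hℓp.ne_zero hn0, Finset.mem_union, hℓp.primeFactors,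
      Finset.mem_singleton] at hq
    rcases hq with rfl | hq
    · exact hTA w hw
    · exact hA q hq w (sup_le_sup_right hZ'le Pas hw)
  · -- ### the invariant (I) for `ℓ n`
    intro i hi
    have hSel : ((S.p : ℤ) ^ i) • S.c (ℓ * n) ∈ S.Sel := hWSel (hW hi)
    have hAℓ : ((S.p : ℤ) ^ i) • S.c n ∈ S.A ℓ :=
      (S.c_mem_loc_iff ℓ n hℓ hsupp i).mp ((S.mem_sel_iff _).mp hSel (S.pl ℓ))
    -- Fact B: `p^i c(n)_λ = 0 ⟹ I ≤ i`
    have hB0 : I ≤ i := by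
      by_contra h
      exact hcA i (by omega) hAℓ
    by_cases hN : S.expo z = 0
    · rw [hN]
      omega
    by_contra hlt
    have hroomz := hroom z (hAct hz)
    have hNi : S.expo z ≤ i := by omega
    -- (21): `p^{i - N} c(n)_λ ≠ 0`
    have hnot : ((S.p : ℤ) ^ (0 + (i - S.expo z))) • S.c n ∉ S.A ℓ := by
      rw [zero_add]
      exact hcA _ (by omega)
    -- (22): `z` has full order at `λ`
    have hzfull : ((S.p : ℤ) ^ (S.expo z - 1)) • z ∉ S.A ℓ := hzA _ (by omega)
    have hτz : z ∈ S.eig (S.ε * (-1) ^ (ℓ * n).primeFactors.card) := by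
      rw [hcard']
      exact hzν
    have hAq : ∀ q ∈ n.primeFactors, z ∈ S.A q := fun q hq ↦ hA q hq z (AddSubgroup.mem_sup_left hz)
    have hzSel : z ∈ S.Sel := hWSel (hAct hz)
    have hne := hCTV ℓ n hℓ hsupp hndvd i (S.expo z) 0 (S.expo z - 1) z hzSel hSel (hW hi) (hAct hz)
      (pow_expo_zsmul S z) hτz hAq (by omega) hroomz hNi (by omega) hnot hzfull
    -- isotropy of `W ∋ p^i c(ℓ n), z`
    exact hne (hiso _ (hW hi) _ (hAct hz) hSel hzSel)

end Summit.BirchSwinnertonDyer.BirchSwinnertonDyer.Theorems.KolyvaginAdaptiveData
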